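import Mathlib
import HarnessLib
import Literature.MathematicalPhysics.KineticTheory.HardSphereEulerProofs
import Literature.Analysis.FluidPDE.CollisionalTransfer
import Summits.AtomisticToContinuum.HydrodynamicLimit.Theses.OneFlightGossipEngine
import Summits.AtomisticToContinuum.HydrodynamicLimit.Theorems.OneFlightGossipEngineKineticCurrentsWindowLDSplit
import Summits.AtomisticToContinuum.HydrodynamicLimit.Theorems.OneFlightGossipEngineKineticCurrentsWindowLDApriori

/-!
# Kinetic-window transport tightness splits into a displacement part and a collisional part — glue
# `stub_windowTransportFamily_of_parts` of line `Sketch`, crux `KineticCurrentsLDAlongFamilies`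
# (stmt-AtomisticToContinuum-16659)

Route `OneFlightGossipEngine`, sub-problem `HydrodynamicLimit`. Reshape of the open dynamical input S2''
`stub_windowTransportFamily` of the skeleton `Cruxes/KineticCurrentsLDAlongFamilies/Lines/Sketch.lean`
(exponential tightness, rate before budget, of the window changes of the tested kinetic energy
`E_ϑ = Σᵢ ϑ(xᵢ)‖vᵢ‖²/2` and tested momentum `M_J = Σᵢ ⟪J(xᵢ), vᵢ⟫` under the local Gibbs law `λ^N_s`):
with the exact splitting
`E_ϑ(Φ_r z) − E_ϑ(z) = Σᵢ (ϑ(xᵢ(r)) − ϑ(xᵢ(0)))·‖vᵢ(0)‖²/2 + Σᵢ ϑ(xᵢ(r))·(‖vᵢ(r)‖² − ‖vᵢ(0)‖²)/2`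
(displacement part + collisional redistribution part), S2'' follows from the tightness of the two parts
separately (S2''a: displacement, decay-free, landed as `stub_displacementTightnessFamily`; S2''b: collisional
redistribution + momentum, OPEN) by one Cauchy–Schwarz step in `ℝ≥0∞` at half the smaller rate.

References: S. Olla, S. R. S. Varadhan, H.-T. Yau, Comm. Math. Phys. 155 (1993) §2; H. Spohn, *Large Scale
Dynamics of Interacting Particles* (1991), Part I §2.3.
-/

noncomputable section

open MeasureTheory Set Filter
open scoped ENNReal Topology InnerProductSpace

namespace Summit.AtomisticToContinuum.HydrodynamicLimit.Theorems.KineticCurrentsLDAlongFamiliesSketch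

open Literature.Analysis.FluidPDE (HardSphereFlow Config localMaxwellian canonicalDensity liouville
  hardSphereDomain configEnergy energyObservable momentumObservable)
open Literature.MathematicalPhysics.KineticTheory (T3 V3 hsDiameter localGibbsLaw localGibbsMeasure
  localGibbsProfile)
open Literature.Analysis.FluidPDE Literature.MathematicalPhysics.KineticTheory

/-- **The exact splitting of the window change of the tested kinetic energy**:
`E_ϑ(z') − E_ϑ(z) = Σᵢ (ϑ(x'ᵢ) − ϑ(xᵢ))‖vᵢ‖²/2 + Σᵢ ϑ(x'ᵢ)(‖v'ᵢ‖² − ‖vᵢ‖²)/2`. [folklore] -/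
theorem wts_energyObservable_sub_eq {n : ℕ} (ϑ : T3 → ℝ) (z z' : Config n (Fin 3) T3) :
    energyObservable ϑ z' - energyObservable ϑ z =
      (∑ i, (ϑ (z' i).1 - ϑ (z i).1) * (‖(z i).2‖ ^ 2 / 2)) +
        ∑ i, ϑ (z' i).1 * (‖(z' i).2‖ ^ 2 / 2 - ‖(z i).2‖ ^ 2 / 2) := by
  unfold energyObservable
  rw [← Finset.sum_sub_distrib, ← Finset.sum_add_distrib]
  exact Finset.sum_congr rfl fun i _ => by ring

/-- Measurability of the displacement part `z ↦ Σᵢ (ϑ(xᵢ(r)) − ϑ(xᵢ(0)))‖vᵢ(0)‖²/2`. [folklore] -/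
theorem wts_measurable_disp {ε : ℝ} {n : ℕ} (Φ : HardSphereFlow (Torus.geometry (Fin 3)) ε n)
    {ϑ : T3 → ℝ} (hϑ : Continuous ϑ) (r : ℝ) :
    Measurable fun z : Config n (Fin 3) T3 =>
      ∑ i, (ϑ (Φ.flow r z i).1 - ϑ (z i).1) * (‖(z i).2‖ ^ 2 / 2) := by
  refine Finset.measurable_sum _ fun i _ => ?_
  exact ((hϑ.measurable.comp ((measurable_pi_apply i).comp (Φ.measurable_flow r)).fst).sub
    (hϑ.measurable.comp (measurable_pi_apply i).fst)).mul
    (((measurable_pi_apply i).snd.norm.pow_const 2).div_const 2)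

/-- Measurability of the collisional part plus the momentum transport. [folklore] -/
theorem wts_measurable_coll {ε : ℝ} {n : ℕ} (Φ : HardSphereFlow (Torus.geometry (Fin 3)) ε n)
    {ϑ : T3 → ℝ} {J : T3 → V3} (hϑ : Continuous ϑ) (hJ : Continuous J) (r : ℝ) :
    Measurable fun z : Config n (Fin 3) T3 =>
      |∑ i, ϑ (Φ.flow r z i).1 * (‖(Φ.flow r z i).2‖ ^ 2 / 2 - ‖(z i).2‖ ^ 2 / 2)| +
        |momentumObservable J (Φ.flow r z) - momentumObservable J z| := by
  have hM : Measurable fun z : Config n (Fin 3) T3 => momentumObservable J z := by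
    unfold momentumObservable
    exact Finset.measurable_sum _ fun i _ =>
      (hJ.measurable.comp (measurable_pi_apply i).fst).inner (measurable_pi_apply i).snd
  refine (Finset.measurable_sum _ fun i _ => ?_).abs.add ((hM.comp (Φ.measurable_flow r)).sub hM).abs
  exact (hϑ.measurable.comp ((measurable_pi_apply i).comp (Φ.measurable_flow r)).fst).mul
    (((((measurable_pi_apply i).comp (Φ.measurable_flow r)).snd.norm.pow_const 2).div_const 2).sub
      (((measurable_pi_apply i).snd.norm.pow_const 2).div_const 2))

/-- **S2'' from its two parts** (glue `stub_windowTransportFamily_of_parts` of line `Sketch`): the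
displacement tightness (S2''a) and the collisional-redistribution + momentum tightness (S2''b), each with its
own rate before the budget and its own threshold uniform in `s ∈ [0,t₁]`, give the registered kinetic-window
transport tightness `stub_windowTransportFamily` with the rate `min(s_a, s_b)/2`: the exact splitting of
`ΔE_ϑ`, `|ΔE_ϑ| ≤ |X_disp| + |X_coll|`, Cauchy–Schwarz `∫e^{X+Y} ≤ (∫e^{2X})^{1/2}(∫e^{2Y})^{1/2}`, and
monotonicity of exponential moments of non-negative functionals in the rate. [folklore] -/
theorem stub_windowTransportFamily_of_parts :
    (∀ (t₁ : ℝ) (a θ₀ : ℝ → T3 → ℝ) (u₀ : ℝ → T3 → V3),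
      Continuous (Function.uncurry a) → Continuous (Function.uncurry θ₀) →
      Continuous (Function.uncurry u₀) → (∀ s x, 0 < a s x) → (∀ s x, 0 < θ₀ s x) →
      ∀ σ : ℝ, 0 < σ → σ ≤ 1 / 2 →
      ∀ ϑ : ℝ → T3 → ℝ, Continuous (Function.uncurry ϑ) →
      ∃ s₀ : ℝ, 0 < s₀ ∧ ∀ τ : ℝ, 0 < τ → ∀ κ : ℝ, 0 < κ →
      ∀ Φ : (N : ℕ) →
        HardSphereFlow (Literature.Analysis.FluidPDE.Torus.geometry (Fin 3)) (hsDiameter σ N) (N + 1),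
      ∃ N₀ : ℕ, ∀ N : ℕ, N₀ ≤ N → ∀ s ∈ Icc 0 t₁,
      ∀ r ∈ Icc (0 : ℝ) (τ * ((N : ℝ) + 1) ^ (-(1 / 3 : ℝ))),
        ∫⁻ z, ENNReal.ofReal (Real.exp (s₀ *
            |∑ i, (ϑ s ((Φ N).flow r z i).1 - ϑ s (z i).1) * (‖(z i).2‖ ^ 2 / 2)|))
          ∂(localGibbsLaw σ (a s) (u₀ s) (θ₀ s) N (Φ N)) ≤
        ENNReal.ofReal (Real.exp (κ * ((N : ℝ) + 1)))) →
    (∀ (t₁ : ℝ) (a θ₀ : ℝ → T3 → ℝ) (u₀ : ℝ → T3 → V3),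
      Continuous (Function.uncurry a) → Continuous (Function.uncurry θ₀) →
      Continuous (Function.uncurry u₀) → (∀ s x, 0 < a s x) → (∀ s x, 0 < θ₀ s x) →
      ∀ σ : ℝ, 0 < σ → σ ≤ 1 / 2 →
      ∀ (ϑ : ℝ → T3 → ℝ) (J : ℝ → T3 → V3), Continuous (Function.uncurry ϑ) →
      Continuous (Function.uncurry J) →
      ∃ s₀ : ℝ, 0 < s₀ ∧ ∀ τ : ℝ, 0 < τ → ∀ κ : ℝ, 0 < κ →
      ∀ Φ : (N : ℕ) →
        HardSphereFlow (Literature.Analysis.FluidPDE.Torus.geometry (Fin 3)) (hsDiameter σ N) (N + 1),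
      ∃ N₀ : ℕ, ∀ N : ℕ, N₀ ≤ N → ∀ s ∈ Icc 0 t₁,
      ∀ r ∈ Icc (0 : ℝ) (τ * ((N : ℝ) + 1) ^ (-(1 / 3 : ℝ))),
        ∫⁻ z, ENNReal.ofReal (Real.exp (s₀ *
            (|∑ i, ϑ s ((Φ N).flow r z i).1 *
                (‖((Φ N).flow r z i).2‖ ^ 2 / 2 - ‖(z i).2‖ ^ 2 / 2)| +
              |momentumObservable (J s) ((Φ N).flow r z) - momentumObservable (J s) z|)))
          ∂(localGibbsLaw σ (a s) (u₀ s) (θ₀ s) N (Φ N)) ≤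
        ENNReal.ofReal (Real.exp (κ * ((N : ℝ) + 1)))) →
    ∀ (t₁ : ℝ) (a θ₀ : ℝ → T3 → ℝ) (u₀ : ℝ → T3 → V3),
    Continuous (Function.uncurry a) → Continuous (Function.uncurry θ₀) →
    Continuous (Function.uncurry u₀) → (∀ s x, 0 < a s x) → (∀ s x, 0 < θ₀ s x) →
    ∀ σ : ℝ, 0 < σ → σ ≤ 1 / 2 →
    ∀ (ϑ : ℝ → T3 → ℝ) (J : ℝ → T3 → V3), Continuous (Function.uncurry ϑ) →
    Continuous (Function.uncurry J) →
    ∃ s₀ : ℝ, 0 < s₀ ∧ ∀ τ : ℝ, 0 < τ → ∀ κ : ℝ, 0 < κ →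
    ∀ Φ : (N : ℕ) →
      HardSphereFlow (Literature.Analysis.FluidPDE.Torus.geometry (Fin 3)) (hsDiameter σ N) (N + 1),
    ∃ N₀ : ℕ, ∀ N : ℕ, N₀ ≤ N → ∀ s ∈ Icc 0 t₁,
    ∀ r ∈ Icc (0 : ℝ) (τ * ((N : ℝ) + 1) ^ (-(1 / 3 : ℝ))),
      ∫⁻ z, ENNReal.ofReal (Real.exp (s₀ *
          (|energyObservable (ϑ s) ((Φ N).flow r z) - energyObservable (ϑ s) z| +
            |momentumObservable (J s) ((Φ N).flow r z) - momentumObservable (J s) z|)))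
        ∂(localGibbsLaw σ (a s) (u₀ s) (θ₀ s) N (Φ N)) ≤
      ENNReal.ofReal (Real.exp (κ * ((N : ℝ) + 1))) := by
  intro hA hB t₁ a θ₀ u₀ ha hθ hu ha0 hθ0 σ hσ hσ2 ϑ J hϑ hJ
  obtain ⟨sa, hsa0, hsa⟩ := hA t₁ a θ₀ u₀ ha hθ hu ha0 hθ0 σ hσ hσ2 ϑ hϑ
  obtain ⟨sb, hsb0, hsb⟩ := hB t₁ a θ₀ u₀ ha hθ hu ha0 hθ0 σ hσ hσ2 ϑ J hϑ hJ
  refine ⟨min sa sb / 2, by positivity, ?_⟩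
  intro τ hτ κ hκ Φ
  obtain ⟨Na, hNa⟩ := hsa τ hτ κ hκ Φ
  obtain ⟨Nb, hNb⟩ := hsb τ hτ κ hκ Φ
  refine ⟨max Na Nb, fun N hN s hsI r hr => ?_⟩
  have h₁ := hNa N (le_of_max_le_left hN) s hsI r hr
  have h₂ := hNb N (le_of_max_le_right hN) s hsI r hr
  have hϑs : Continuous (ϑ s) := hϑ.uncurry_left s
  have hJs : Continuous (J s) := hJ.uncurry_left s
  -- abbreviations
  have hs2a : 2 * (min sa sb / 2) ≤ sa := by linarith [min_le_left sa sb]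
  have hs2b : 2 * (min sa sb / 2) ≤ sb := by linarith [min_le_right sa sb]
  have hs0 : 0 ≤ min sa sb / 2 := by positivity
  -- the two functionals
  have hXm := wts_measurable_disp (Φ N) hϑs r
  have hYm := wts_measurable_coll (Φ N) hϑs hJs r
  -- Step 1: pointwise `|ΔE| + |ΔM| ≤ |X| + (|Y| + |ΔM|)` and monotonicity in the rate
  have hpt : ∀ z : Config (N + 1) (Fin 3) T3,
      ENNReal.ofReal (Real.exp (min sa sb / 2 *
          (|energyObservable (ϑ s) ((Φ N).flow r z) - energyObservable (ϑ s) z| +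
            |momentumObservable (J s) ((Φ N).flow r z) - momentumObservable (J s) z|))) ≤
        ENNReal.ofReal (Real.exp (min sa sb / 2 *
            |∑ i, (ϑ s ((Φ N).flow r z i).1 - ϑ s (z i).1) * (‖(z i).2‖ ^ 2 / 2)| +
          min sa sb / 2 *
            (|∑ i, ϑ s ((Φ N).flow r z i).1 *
                (‖((Φ N).flow r z i).2‖ ^ 2 / 2 - ‖(z i).2‖ ^ 2 / 2)| +
              |momentumObservable (J s) ((Φ N).flow r z) - momentumObservable (J s) z|))) := by
    intro z
    refine ENNReal.ofReal_le_ofReal (Real.exp_le_exp.2 ?_)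
    rw [wts_energyObservable_sub_eq (ϑ s) z ((Φ N).flow r z), ← mul_add]
    refine mul_le_mul_of_nonneg_left ?_ hs0
    have := abs_add_le (∑ i, (ϑ s ((Φ N).flow r z i).1 - ϑ s (z i).1) * (‖(z i).2‖ ^ 2 / 2))
      (∑ i, ϑ s ((Φ N).flow r z i).1 * (‖((Φ N).flow r z i).2‖ ^ 2 / 2 - ‖(z i).2‖ ^ 2 / 2))
    linarith
  -- Step 2: Cauchy–Schwarz
  have hCS := lintegral_exp_add_le_sqrt (μ := localGibbsLaw σ (a s) (u₀ s) (θ₀ s) N (Φ N))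
    ((hXm.abs.const_mul (min sa sb / 2)).aemeasurable) ((hYm.const_mul (min sa sb / 2)).aemeasurable)
  -- Step 3: monotonicity in the rate and the two hypotheses
  have hE0 : ENNReal.ofReal (Real.exp (κ * ((N : ℝ) + 1))) ≠ 0 :=
    (ENNReal.ofReal_pos.2 (Real.exp_pos _)).ne'
  have hI₁ : ∫⁻ z, ENNReal.ofReal (Real.exp (2 * (min sa sb / 2 *
        |∑ i, (ϑ s ((Φ N).flow r z i).1 - ϑ s (z i).1) * (‖(z i).2‖ ^ 2 / 2)|)))
        ∂(localGibbsLaw σ (a s) (u₀ s) (θ₀ s) N (Φ N)) ≤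
      ENNReal.ofReal (Real.exp (κ * ((N : ℝ) + 1))) := by
    refine (lintegral_mono fun z => ?_).trans h₁
    refine ENNReal.ofReal_le_ofReal (Real.exp_le_exp.2 ?_)
    rw [← mul_assoc]
    exact mul_le_mul_of_nonneg_right hs2a (abs_nonneg _)
  have hI₂ : ∫⁻ z, ENNReal.ofReal (Real.exp (2 * (min sa sb / 2 *
        (|∑ i, ϑ s ((Φ N).flow r z i).1 *
            (‖((Φ N).flow r z i).2‖ ^ 2 / 2 - ‖(z i).2‖ ^ 2 / 2)| +
          |momentumObservable (J s) ((Φ N).flow r z) - momentumObservable (J s) z|))))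
        ∂(localGibbsLaw σ (a s) (u₀ s) (θ₀ s) N (Φ N)) ≤
      ENNReal.ofReal (Real.exp (κ * ((N : ℝ) + 1))) := by
    refine (lintegral_mono fun z => ?_).trans h₂
    refine ENNReal.ofReal_le_ofReal (Real.exp_le_exp.2 ?_)
    rw [← mul_assoc]
    exact mul_le_mul_of_nonneg_right hs2b (by positivity)
  calc ∫⁻ z, ENNReal.ofReal (Real.exp (min sa sb / 2 *
          (|energyObservable (ϑ s) ((Φ N).flow r z) - energyObservable (ϑ s) z| +
            |momentumObservable (J s) ((Φ N).flow r z) - momentumObservable (J s) z|)))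
        ∂(localGibbsLaw σ (a s) (u₀ s) (θ₀ s) N (Φ N))
      ≤ _ := lintegral_mono hpt
    _ ≤ _ := hCS
    _ ≤ ENNReal.ofReal (Real.exp (κ * ((N : ℝ) + 1))) ^ (1 / 2 : ℝ) *
          ENNReal.ofReal (Real.exp (κ * ((N : ℝ) + 1))) ^ (1 / 2 : ℝ) :=
        mul_le_mul (ENNReal.rpow_le_rpow hI₁ (by norm_num)) (ENNReal.rpow_le_rpow hI₂ (by norm_num))
          bot_le bot_le
    _ = ENNReal.ofReal (Real.exp (κ * ((N : ℝ) + 1))) := by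
        rw [← ENNReal.rpow_add _ _ hE0 ENNReal.ofReal_ne_top]
        norm_num

end Summit.AtomisticToContinuum.HydrodynamicLimit.Theorems.KineticCurrentsLDAlongFamiliesSketch

end
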